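import Literature.NumberTheory.LFunctions.SchoenfeldZeroSums
import Literature.NumberTheory.LFunctions.ZetaArgBacklundExplicit
import Literature.NumberTheory.LFunctions.RiemannSiegelFacts
import Literature.NumberTheory.LFunctions.TuringMethod
import Summits.RiemannHypothesis.RiemannHypothesis.Theorems.LiCoefficientsDefs
import HarnessLib

/-!
# RiemannHypothesis / LiCoefficients — crux `LiWindowLowerBound`, part A (RH-FREE): window identity (S1),
# ϑ main term (S2), Backlund boundary terms (S4)

* S1 `windowIdentity`: for `0 ≤ a ≤ b`, `f ∈ C¹[a,b]`,
  `∑_{a < Im ρ ≤ b} m(ρ) f(Im ρ) = (1/π)∫_a^b f ϑ' + S(b) f(b) − S(a) f(a) − ∫_a^b S f'`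
  (partial summation `sum_zerosBetween_eq` + `N = ϑ/π + 1 + S` + one integration by parts of the smooth part).
* S2 `thetaMain`: `(1/π)∫_{b/2}^b ϑ' ≥ b/(4π)(log(b/2π) − 0.31) − 0.4413` for `b ≥ 1100` (Stirling for `ϑ`).
* S4 `backlundBoundary`: `|S(b) f_n(b)| + |S(b/2) f_n(b/2)| ≤ 1.24 log b + 12.96` (`|S(t)| ≤ 0.3083 log t + 3.24`).

RH-FREE [rh-li-prover]: every input is a proved tree theorem about the zeros of `ζ` (zero counting, Backlund's explicit
`S(t)` bound, Turing's bound, Stirling for `ϑ`); no hypothesis on the real parts of the zeros is used.  Part of the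
PROOF-OF-DATA rung L-P(P1) of the RH ladder's column LI; nothing here bears on the truth of RH.
-/

noncomputable section

-- D-0017: `Summit.<S>.<S>.…` is the designed namespace of a single-problem summit.
set_option linter.dupNamespace false

open Real Set MeasureTheory intervalIntegral Filter
open scoped Real Topology

namespace Summit.RiemannHypothesis.RiemannHypothesis.Theorems.LiTheory

open Literature.NumberTheory.LFunctions Literature.NumberTheory.LFunctions.SchoenfeldBound

namespace Window

/-! ### S1 — the window identity -/

/-- **S1 (window identity).**  For `0 ≤ a ≤ b` and `f ∈ C¹[a,b]`:
`∑_{a < Im ρ ≤ b} m(ρ) f(Im ρ) = (1/π)∫_a^b f ϑ' + S(b) f(b) − S(a) f(a) − ∫_a^b S f'`. -/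
theorem windowIdentity {a b : ℝ} (ha : 0 ≤ a) (hab : a ≤ b) {f f' : ℝ → ℝ}
    (hf : ∀ t ∈ Icc a b, HasDerivAt f (f' t) t) (hf' : ContinuousOn f' (Icc a b)) :
    ∑ ρ ∈ zerosBetween a b, (riemannZetaZeroOrder ρ : ℝ) * f ρ.im =
      1 / Real.pi * (∫ t in a..b, f t * riemannSiegelThetaDeriv t)
        + zetaArgS b * f b - zetaArgS a * f a - ∫ t in a..b, zetaArgS t * f' t := by
  rw [sum_zerosBetween_eq ha hab hf hf']
  have hπ : (π : ℝ) ≠ 0 := Real.pi_ne_zero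
  have hN : ∀ t, (zetaZeroCount t : ℝ) = zetaArgS t + riemannSiegelTheta t / π + 1 := by
    intro t; simp only [zetaArgS]; ring
  have hf_uIcc : ∀ t ∈ uIcc a b, HasDerivAt f (f' t) t := fun t ht ↦ hf t (by rwa [uIcc_of_le hab] at ht)
  have hf'int : IntervalIntegrable f' volume a b := hf'.intervalIntegrable_of_Icc hab
  have hff : ∫ t in a..b, f' t = f b - f a := integral_eq_sub_of_hasDerivAt hf_uIcc hf'int
  -- by parts for the smooth part `ϑ`
  have hθparts : ∫ t in a..b, (riemannSiegelTheta t - riemannSiegelTheta a) * f' t =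
      (riemannSiegelTheta b - riemannSiegelTheta a) * f b -
        ∫ t in a..b, riemannSiegelThetaDeriv t * f t := by
    have h := intervalIntegral.integral_mul_deriv_eq_deriv_mul (a := a) (b := b)
      (u := fun t ↦ riemannSiegelTheta t - riemannSiegelTheta a) (u' := riemannSiegelThetaDeriv)
      (v := f) (v' := f')
      (fun t _ ↦ (hasDerivAt_riemannSiegelTheta_holds t).sub_const _) hf_uIcc
      (continuous_riemannSiegelThetaDeriv_holds.intervalIntegrable _ _) hf'int
    rw [h]; simp
  -- split the integrand
  have hS : IntervalIntegrable (fun t ↦ zetaArgS t * f' t) volume a b :=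
    (intervalIntegrable_zetaArgS a b).mul_continuousOn (by rwa [uIcc_of_le hab])
  have hΘ : IntervalIntegrable (fun t ↦ (riemannSiegelTheta t - riemannSiegelTheta a) * f' t) volume a b :=
    ((continuous_riemannSiegelTheta.sub continuous_const).continuousOn.mul hf').intervalIntegrable_of_Icc hab
  have hsplit : ∫ t in a..b, ((zetaZeroCount t : ℝ) - zetaZeroCount a) * f' t =
      (∫ t in a..b, zetaArgS t * f' t) +
        (1 / π * (∫ t in a..b, (riemannSiegelTheta t - riemannSiegelTheta a) * f' t)
          - zetaArgS a * ∫ t in a..b, f' t) := by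
    rw [← intervalIntegral.integral_const_mul, ← intervalIntegral.integral_const_mul,
      ← intervalIntegral.integral_sub (hΘ.const_mul _) (hf'int.const_mul _),
      ← intervalIntegral.integral_add hS ((hΘ.const_mul _).sub (hf'int.const_mul _))]
    refine intervalIntegral.integral_congr fun t _ ↦ ?_
    simp only [hN t, hN a]
    field_simp
    ring
  have hcomm : (∫ t in a..b, riemannSiegelThetaDeriv t * f t) = ∫ t in a..b, f t * riemannSiegelThetaDeriv t :=
    intervalIntegral.integral_congr fun t _ ↦ mul_comm _ _
  rw [hsplit, hθparts, hff, hN b, hN a, hcomm]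
  field_simp
  ring

/-! ### S2 — the main term of `ϑ` -/

/-- `2 K(¼) ≤ 1.171` for the Stirling constant `K = stirlingVertRate (1/4)`. -/
theorem two_stirlingVertRate_le : 2 * stirlingVertRate (1 / 4) ≤ 1.171 := by
  unfold stirlingVertRate
  have hπ := Real.pi_lt_d4
  nlinarith

/-- **S2 (ϑ main term).**  For `b ≥ 1100`: `b/(4π)(log(b/2π) − 0.31) − 0.4413 ≤ (1/π)∫_{b/2}^b ϑ'`
(`∫ϑ' = ϑ(b) − ϑ(b/2)` and Stirling's formula `abs_riemannSiegelTheta_sub_stirling_le` twice;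
`1 − log 2 = 0.3069 < 0.31`). -/
theorem thetaMain {b : ℝ} (hb : 1100 ≤ b) :
    b / (4 * Real.pi) * (Real.log (b / (2 * Real.pi)) - 0.31) - 0.4413 ≤
      1 / Real.pi * ∫ t in (b / 2)..b, riemannSiegelThetaDeriv t := by
  have hπ0 := Real.pi_pos
  have hπ := Real.pi_lt_d4
  have hb0 : 0 < b := by linarith
  have hFTC : ∫ t in (b / 2)..b, riemannSiegelThetaDeriv t =
      riemannSiegelTheta b - riemannSiegelTheta (b / 2) :=
    integral_eq_sub_of_hasDerivAt (fun t _ ↦ hasDerivAt_riemannSiegelTheta_holds t)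
      (continuous_riemannSiegelThetaDeriv_holds.intervalIntegrable _ _)
  rw [hFTC]
  have h1 := abs_le.1 (abs_riemannSiegelTheta_sub_stirling_le (t := b) (by linarith))
  have h2 := abs_le.1 (abs_riemannSiegelTheta_sub_stirling_le (t := b / 2) (by linarith))
  have hK := two_stirlingVertRate_le
  have hK0 : 0 ≤ 2 * stirlingVertRate (1 / 4) := by unfold stirlingVertRate; positivity
  have hlog : Real.log (b / 2 / (2 * π)) = Real.log (b / (2 * π)) - Real.log 2 := by
    rw [show b / 2 / (2 * π) = (b / (2 * π)) / 2 by ring,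
      Real.log_div (ne_of_gt (by positivity)) two_ne_zero]
  have hlog2 := Real.log_two_gt_d9
  set L := Real.log (b / (2 * π)) with hL
  have e1 : 2 * stirlingVertRate (1 / 4) / b ≤ 0.0011 := by
    rw [div_le_iff₀ hb0]; nlinarith
  have e2 : 2 * stirlingVertRate (1 / 4) / (b / 2) ≤ 0.0022 := by
    rw [div_le_iff₀ (by linarith)]; nlinarith
  rw [hlog] at h2
  have hmain : b / 4 * (L - 0.31) - 0.4413 * π ≤ riemannSiegelTheta b - riemannSiegelTheta (b / 2) := by
    nlinarith [h1.1, h2.2]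
  have e : b / (4 * π) * (L - 0.31) - 0.4413 = (b / 4 * (L - 0.31) - 0.4413 * π) / π := by
    field_simp
  rw [e, show 1 / π * (riemannSiegelTheta b - riemannSiegelTheta (b / 2)) =
    (riemannSiegelTheta b - riemannSiegelTheta (b / 2)) / π by ring]
  exact div_le_div_of_nonneg_right hmain hπ0.le

/-! ### S4 — Backlund boundary terms -/

/-- `0 ≤ f_n ≤ 2`, hence `|f_n| ≤ 2`. -/
theorem abs_liWindowWeight_le (n : ℕ) (t : ℝ) : |liWindowWeight n t| ≤ 2 := by
  unfold liWindowWeight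
  have h1 := Real.cos_le_one (n * liZeroAngle t)
  have h2 := Real.neg_one_le_cos (n * liZeroAngle t)
  rw [abs_le]; constructor <;> linarith

/-- **S4 (Backlund boundary terms).**  For `b ≥ 1100`:
`|S(b) f_n(b)| + |S(b/2) f_n(b/2)| ≤ 1.24 log b + 12.96`. -/
theorem backlundBoundary (n : ℕ) {b : ℝ} (hb : 1100 ≤ b) :
    |zetaArgS b * liWindowWeight n b| + |zetaArgS (b / 2) * liWindowWeight n (b / 2)| ≤
      1.24 * Real.log b + 12.96 := by
  have hS1 := abs_zetaArgS_le_explicit (T := b) (by linarith)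
  have hS2 := abs_zetaArgS_le_explicit (T := b / 2) (by linarith)
  have hw1 := abs_liWindowWeight_le n b
  have hw2 := abs_liWindowWeight_le n (b / 2)
  have hlog : Real.log (b / 2) ≤ Real.log b := Real.log_le_log (by linarith) (by linarith)
  have hlog0 : 0 ≤ Real.log b := Real.log_nonneg (by linarith)
  rw [abs_mul, abs_mul]
  have m1 := mul_le_mul hS1 hw1 (abs_nonneg _) (by linarith [abs_nonneg (zetaArgS b)])
  have m2 := mul_le_mul hS2 hw2 (abs_nonneg _) (by linarith [abs_nonneg (zetaArgS (b / 2))])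
  linarith

end Window

end Summit.RiemannHypothesis.RiemannHypothesis.Theorems.LiTheory

end
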